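import Literature.Algebra.Homology.DiscreteRepOpenSubgroup
import Mathlib.CategoryTheory.Preadditive.LeftExact
import Mathlib.CategoryTheory.Limits.Constructions.EpiMono
import HarnessLib

/-!
# Restriction functors on discrete representations are exact (any subgroup, any continuous map)

Topic `Algebra/Homology`; namespace `Literature.Algebra.Homology.DiscreteRep`.  Sequel of
`DiscreteRepCategory` / `DiscreteRepOpenSubgroup`; no named fact, no `sorry`.

* The inclusion `ι : C_Γ ⥤ Rep k Γ` is exact (instances `PreservesFiniteLimits (ι k Γ)`,
  `PreservesFiniteColimits (ι k Γ)`): it preserves kernels and cokernels (Mathlib's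
  `ObjectProperty.preservesKernels_ι` / `preservesCokernels_ι`), hence all finite (co)limits.
* `resDHom φ hφ : C_Γ ⥤ C_H` — restriction along a CONTINUOUS group homomorphism `φ : H →* Γ`
  (e.g. a decomposition group `Γ_{K_v} → Γ_K`, or any closed subgroup), and
  **exactness instances** for it and for `resD k U` (`U` ANY subgroup; no openness / finite index
  needed, superseding the hypotheses of `preservesFiniteLimits_resD U hU`): `Res ⋙ ι = ι ⋙ Rep.resFunctor`
  preserves finite (co)limits (`Rep.resFunctor` has both adjoints) and `ι` reflects them.

Consequence: `Ext.mapExactFunctor (resD k U)` / `(resDHom φ hφ)` and the functoriality engine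
`ExtOfAcyclicResolutionFunctoriality(Squares)` are available for restriction to arbitrary closed
subgroups (Route A of crux `stmt-BirchSwinnertonDyer-19295`, local–global maps).

## References
* D. Harari, *Galois Cohomology and Class Field Theory*, Springer (2020), §4.2 (the abelian category
  `C_G`), §1.5 (restriction). [Harari2020]
-/

noncomputable section

universe u

namespace Literature.Algebra.Homology

namespace DiscreteRep

open CategoryTheory CategoryTheory.Limits

variable {k Γ : Type u} [CommRing k] [Group Γ] [TopologicalSpace Γ] [IsTopologicalGroup Γ]

/-! ## §1 The inclusion `ι : C_Γ ⥤ Rep k Γ` is exact -/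

/-- `ι` preserves finite limits. [cite: Harari2020, §4.2, after Definition 4.14] -/
instance preservesFiniteLimits_ι : PreservesFiniteLimits (ι k Γ) :=
  haveI : ∀ {X Y : DiscreteRepCat k Γ} (f : X ⟶ Y), PreservesLimit (parallelPair f 0) (ι k Γ) :=
    fun f => (isDiscrete k Γ).preservesKernels_ι f
  (ι k Γ).preservesFiniteLimits_of_preservesKernels

/-- `ι` preserves finite colimits. [cite: Harari2020, §4.2, after Definition 4.14] -/
instance preservesFiniteColimits_ι : PreservesFiniteColimits (ι k Γ) :=
  haveI : ∀ {X Y : DiscreteRepCat k Γ} (f : X ⟶ Y), PreservesColimit (parallelPair f 0) (ι k Γ) :=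
    fun f => (isDiscrete k Γ).preservesCokernels_ι f
  (ι k Γ).preservesFiniteColimits_of_preservesCokernels

/-! ## §2 Restriction along a continuous homomorphism -/

section Hom

variable {H : Type u} [Group H] [TopologicalSpace H] [IsTopologicalGroup H] (φ : H →* Γ)
  (hφ : Continuous φ)

include hφ in
omit [IsTopologicalGroup Γ] [IsTopologicalGroup H] in
/-- Restriction along a continuous homomorphism preserves discreteness (stabilisers pull back).
[cite: Harari2020, §4.2] -/
theorem isDiscrete_resHom (A : DiscreteRepCat k Γ) :
    IsDiscrete ((Rep.resFunctor φ).obj A.obj) := fun x => by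
  have h : (stabilizer ((Rep.resFunctor φ).obj A.obj) x : Set H) =
      φ ⁻¹' (stabilizer A.obj x : Set Γ) := by
    ext u
    rfl
  rw [h]
  exact (A.property x).preimage hφ

variable (k) in
/-- **Restriction `Res_φ : C_Γ ⥤ C_H` along a continuous homomorphism `φ : H →* Γ`** (Mathlib's
`Rep.resFunctor φ` on the discrete objects). [cite: Harari2020, §4.2] -/
def resDHom : DiscreteRepCat k Γ ⥤ DiscreteRepCat k H :=
  (isDiscrete k H).lift (ι k Γ ⋙ Rep.resFunctor φ) fun A => isDiscrete_resHom φ hφ A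

/-- `Res_φ ⋙ ι = ι ⋙ Rep.resFunctor φ` (definitionally). [cite: Harari2020, §4.2] -/
def resDHomCompιIso : resDHom k φ hφ ⋙ ι k H ≅ ι k Γ ⋙ Rep.resFunctor φ := Iso.refl _

omit [IsTopologicalGroup Γ] [IsTopologicalGroup H] in
/-- On objects. [cite: Harari2020, §4.2] -/
@[simp]
theorem resDHom_obj_obj (A : DiscreteRepCat k Γ) :
    ((resDHom k φ hφ).obj A).obj = (Rep.resFunctor φ).obj A.obj := rfl

omit [IsTopologicalGroup Γ] [IsTopologicalGroup H] in
/-- On morphisms (the underlying linear map is unchanged). [cite: Harari2020, §4.2] -/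
@[simp]
theorem resDHom_map_hom_apply {A B : DiscreteRepCat k Γ} (f : A ⟶ B) (x : A.obj.V) :
    ((resDHom k φ hφ).map f).hom.hom x = f.hom.hom x := rfl

omit [IsTopologicalGroup Γ] [IsTopologicalGroup H] in
/-- `Res_φ` of a trivial representation is trivial (definitionally). [cite: Harari2020, §4.2] -/
theorem resDHom_triv (V : Type u) [AddCommGroup V] [Module k V] :
    (resDHom k φ hφ).obj (triv (Γ := Γ) V) = triv (Γ := H) V := rfl

/-- `Res_φ` is additive. [cite: Harari2020, §4.2] -/
instance : (resDHom k φ hφ).Additive where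
  map_add := rfl

/-- **`Res_φ` preserves finite limits.** [cite: Harari2020, §4.2 and §1.5] -/
instance preservesFiniteLimits_resDHom : PreservesFiniteLimits (resDHom k φ hφ) := by
  haveI : PreservesFiniteLimits (resDHom k φ hφ ⋙ ι k H) :=
    show PreservesFiniteLimits (ι k Γ ⋙ Rep.resFunctor φ) from comp_preservesFiniteLimits _ _
  exact ⟨fun J _ _ => preservesLimitsOfShape_of_reflects_of_preserves (resDHom k φ hφ) (ι k H)⟩

/-- **`Res_φ` preserves finite colimits.** [cite: Harari2020, §4.2 and §1.5] -/
instance preservesFiniteColimits_resDHom : PreservesFiniteColimits (resDHom k φ hφ) := by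
  haveI : PreservesFiniteColimits (resDHom k φ hφ ⋙ ι k H) :=
    show PreservesFiniteColimits (ι k Γ ⋙ Rep.resFunctor φ) from comp_preservesFiniteColimits _ _
  exact ⟨fun J _ _ => preservesColimitsOfShape_of_reflects_of_preserves (resDHom k φ hφ) (ι k H)⟩

/-- `Res_φ` preserves monomorphisms. [cite: Harari2020, §4.2] -/
instance : (resDHom k φ hφ).PreservesMonomorphisms := inferInstance

/-- `Res_φ` preserves epimorphisms. [cite: Harari2020, §4.2] -/
instance : (resDHom k φ hφ).PreservesEpimorphisms := inferInstance

end Hom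

/-! ## §3 Restriction to an arbitrary subgroup is exact -/

section Subgroup

variable (U : Subgroup Γ)

/-- **`Res_U : C_Γ ⥤ C_U` preserves finite limits** for ANY subgroup `U` (no openness or finite index
needed; cf. `preservesFiniteLimits_resD U hU`). [cite: Harari2020, §4.2 and §1.5] -/
instance preservesFiniteLimits_resD' : PreservesFiniteLimits (resD k U) := by
  haveI : PreservesFiniteLimits (resD k U ⋙ ι k U) :=
    show PreservesFiniteLimits (ι k Γ ⋙ Rep.resFunctor U.subtype) from comp_preservesFiniteLimits _ _
  exact ⟨fun J _ _ => preservesLimitsOfShape_of_reflects_of_preserves (resD k U) (ι k U)⟩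

/-- **`Res_U : C_Γ ⥤ C_U` preserves finite colimits** for ANY subgroup `U`. [cite: Harari2020, §4.2 and §1.5] -/
instance preservesFiniteColimits_resD' : PreservesFiniteColimits (resD k U) := by
  haveI : PreservesFiniteColimits (resD k U ⋙ ι k U) :=
    show PreservesFiniteColimits (ι k Γ ⋙ Rep.resFunctor U.subtype) from
      comp_preservesFiniteColimits _ _
  exact ⟨fun J _ _ => preservesColimitsOfShape_of_reflects_of_preserves (resD k U) (ι k U)⟩

/-- `Res_U` preserves epimorphisms. [cite: Harari2020, §4.2] -/
instance : (resD k U).PreservesEpimorphisms := inferInstance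

end Subgroup

end DiscreteRep

end Literature.Algebra.Homology
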